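import Literature.Analysis.FluidPDE.KatoPressureTails
import Literature.Analysis.FluidPDE.KatoRemainderL3
import Literature.Analysis.FluidPDE.KatoContinuationProofs
import Literature.Analysis.FluidPDE.KatoLocalBoundedProofs
import Literature.Analysis.FluidPDE.KatoLocalHolds
import Literature.Analysis.FluidPDE.CKNEpsilonRegularityForce
import Literature.Analysis.FluidPDE.CKNLocalRegularityRRSPressure
import Literature.Analysis.FluidPDE.LerayFarFieldEpsilonRegularitySlab
import HarnessLib

/-!
# The far-field bound of Kato solutions near the blow-up time, and Rusin–Šverák's singular point

Analysis/FluidPDE proof file (theorems only): the discharge of the named fact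
`Literature.Analysis.FluidPDE.IsKatoSolutionOn.farField_bound` (`RusinSverakSingularPoint.lean`)
— a Kato solution on `[0, T)` is essentially bounded on `(T - δ, T) × {|x| > R}` — along the
Calderón / Rusin–Šverák route (W. Rusin, V. Šverák, J. Funct. Anal. 260 (2011) =
arXiv:0911.0500, §4 p. 6: "we decompose `u₀ = v₀ + w₀` [...] the equation for `v`, together with
the local energy inequality, implies that `v` is in the energy class up to the blow-up time [...]
and therefore, for sufficiently large `R > 0`, the assumptions of the ε-regularity criterion are
satisfied in `(T/2, T) × {|x| > R}`"; C. P. Calderón, Trans. AMS 318 (1990), §1;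
P. G. Lemarié-Rieusset, *The Navier–Stokes problem in the 21st century* (2016), Thm. 15.1 (C),
proof p. 566, with Thm. 14.4 and the proof of Thm. 14.5, p. 512), and with it the discharge of
`rusin_sverak_singular_point_of_blowup` (`RusinSverakWeakStability.lean`) and of
`lemarieRieusset_singular_point_of_blowup` (`LemarieRieussetSingularPoint.lean`) through the
tree's assemblies `rusin_sverak_singular_point_of_blowup_of_facts`,
`lemarieRieusset_singular_point_of_blowup_of_facts` (`KatoContinuationProofs.lean`).

The proof of `IsKatoSolutionOn.farField_bound_holds`: restart the solution at a time
`s ∈ (T/4, T/2)` at which the slice is essentially bounded (`IsKatoSolutionOn.restart`,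
`IsKatoSolutionOn.exists_ae_norm_le_of_pos`); the restarted solution `ũ` on `[0, T')`,
`T' = T - s`, lies in `L³((0,T') × ℝ³)`
(`IsKatoSolutionOn.lintegral_enorm_cube_lt_top_of_ae_bounded`: energy class of the caloric
remainder, Sobolev, Hölder), its glued Riesz pressure `P` lies in `L^{3/2}((0,T') × ℝ³)`
(`lintegral_rieszPressure_le`), so the tails `∫∫_{(0,T') × {|x|>n}} (|ũ|³ + |P|^{3/2})` tend to
zero (`tendsto_setLIntegral_prod_compl_closedBall`). For a top `t < T'` the pair `(ũ, p)` with
the Riesz pressure `p` of the slab `(0, (t+T')/2)` is an `IsLRSuitableWeakSolutionOn` on a box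
around every far cylinder `Q_{r₀}(t, x)` (`IsKatoSolutionOn.exists_rieszPressure_suitable_slab`),
`∫∫_Q |p|^{3/2} = ∫∫_Q |P|^{3/2}` (`setLIntegral_prod_eq_of_ae_slice_eq`), and Lemarié-Rieusset's
ε-regularity criterion (`lemarieRieusset_epsilon_regularity_of_lemma15_12 RRS2016.lemma15_12_holds`,
Thm. 14.4) bounds `ũ` by `C₀ε₀/r₀` a.e. on `Q_{r₀/2}(t, x)`; countably many such half-cylinders
cover the far region (`far_region_subset_biUnion_lt`), and the bound is translated back to `u`.

## Mathlib / tree search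

Tree: `IsKatoSolutionOn.restart` (`NSSereginMildCore.lean`), `.exists_ae_norm_le_of_pos`
(`KatoLocalLerayPressure.lean`), `.lintegral_enorm_cube_lt_top_of_ae_bounded`
(`KatoRemainderL3.lean`), `.exists_measurable_rieszPressure`, `lintegral_rieszPressure_le`,
`setLIntegral_prod_eq_of_ae_slice_eq`, `tendsto_setLIntegral_prod_compl_closedBall`
(`KatoPressureTails.lean`), `.exists_rieszPressure_suitable_slab` (`KatoRieszPressureSuitable.lean`),
`lemarieRieusset_epsilon_regularity_iff`, `IsLRSuitableWeakSolutionOn`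
(`CKNEpsilonRegularityProofs.lean`), `lemarieRieusset_epsilon_regularity_of_lemma15_12`
(`CKNEpsilonRegularityForce.lean`), `RRS2016.lemma15_12_holds` (`CKNLocalRegularityRRSPressure.lean`),
`rusin_sverak_singular_point_of_blowup_of_facts`, `lemarieRieusset_singular_point_of_blowup_of_facts`
(`KatoContinuationProofs.lean`), `kato_local_holds` (`KatoLocalHolds.lean`),
`kato_local_bounded_holds` (`KatoLocalBoundedProofs.lean`), `far_region_subset_biUnion_lt`
(`LerayFarFieldEpsilonRegularitySlab.lean`). Mathlib:
`MeasurePreserving.restrict_preimage`, `MeasurableEmbedding.ae_map_iff`,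
`eLpNormEssSup_lt_top_of_ae_bound`, `ae_restrict_biUnion_iff`.

## References

* W. Rusin, V. Šverák, *Minimal initial data for potential Navier–Stokes singularities*,
  J. Funct. Anal. 260 (2011) 879–891 = arXiv:0911.0500, §4 p. 6. [RusinSverak2011]
* P. G. Lemarié-Rieusset, *The Navier–Stokes problem in the 21st century*, CRC Press 2016,
  Thm. 15.1 (C) and its proof (p. 566); Thm. 14.4 (p. 505); proof of Thm. 14.5 (p. 512).
  [LemarieRieusset2016]
* C. P. Calderón, Trans. Amer. Math. Soc. 318 (1990) 179–200, §1. [Calderon1990]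
-/

noncomputable section

open MeasureTheory TopologicalSpace Set Function Filter Topology Metric InnerProductSpace
open scoped ENNReal NNReal RealInnerProductSpace

namespace Literature.Analysis.FluidPDE

set_option maxHeartbeats 1600000 in
/-- **The far-field bound of Kato solutions near the final time holds**
(`IsKatoSolutionOn.farField_bound`; Rusin–Šverák 2011, §4 p. 6; Lemarié-Rieusset 2016,
Thm. 15.1 (C), proof p. 566, with Thm. 14.4 and the proof of Thm. 14.5, p. 512): for `ν > 0`,
`T > 0` and a Kato solution `u` on `[0, T)`, there are `δ > 0` and `R` with
`u ∈ L^∞((T - δ, T) × {|x| > R})`. [cite: RusinSverak2011, §4 p. 6] -/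
theorem IsKatoSolutionOn.farField_bound_holds : IsKatoSolutionOn.farField_bound := by
  intro ν T u₀ u hν hT hu
  -- ### Step 1: restart at an essentially bounded slice `u(s)`, `s ∈ (T/4, T/2)`
  obtain ⟨M, hM⟩ := hu.exists_ae_norm_le_of_pos hν (a := T / 4) (S := T / 2) (by positivity) (by linarith)
  have hprod : (volume.restrict (Ioo (T / 4) (T / 2) ×ˢ (univ : Set (EuclideanSpace ℝ (Fin 3)))) :
      Measure (ℝ × EuclideanSpace ℝ (Fin 3))) = (volume.restrict (Ioo (T / 4) (T / 2))).prod volume := by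
    rw [show (volume : Measure (ℝ × EuclideanSpace ℝ (Fin 3))) = (volume : Measure ℝ).prod volume from rfl,
      ← Measure.prod_restrict, Measure.restrict_univ]
  have hM' : ∀ᵐ s ∂(volume.restrict (Ioo (T / 4) (T / 2))),
      ∀ᵐ x ∂(volume : Measure (EuclideanSpace ℝ (Fin 3))), ‖u s x‖ ≤ M := by
    rw [hprod] at hM
    exact Measure.ae_ae_of_ae_prod hM
  have hne : (ae (volume.restrict (Ioo (T / 4) (T / 2)))).NeBot := by
    rw [ae_neBot, Ne, Measure.restrict_eq_zero, Real.volume_Ioo, ENNReal.ofReal_eq_zero, not_le]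
    linarith
  obtain ⟨s, hsM, hsI⟩ := (hM'.and (ae_restrict_mem measurableSet_Ioo)).exists
  set T' : ℝ := T - s with hT'
  have hT'pos : 0 < T' := by rw [hT']; linarith [hsI.2]
  have hũ : IsKatoSolutionOn T' ν (u s) (fun t => u (s + t)) :=
    hu.restart hν ⟨by linarith [hsI.1], by linarith [hsI.2]⟩
  -- ### Step 2: `ũ ∈ L³((0,T') × ℝ³)` and its measurable Riesz pressure `P ∈ L^{3/2}`
  have hL3 := hũ.lintegral_enorm_cube_lt_top_of_ae_bounded hν hT'pos hsM
  obtain ⟨P, hPm, hP⟩ := hũ.exists_measurable_rieszPressure hν hT'pos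
  have hP32 : ∫⁻ z in Ioo 0 T' ×ˢ (univ : Set (EuclideanSpace ℝ (Fin 3))), ‖P z.1 z.2‖ₑ ^ (3 / 2 : ℝ) < ∞ := by
    refine (lintegral_rieszPressure_le hũ hPm (hP.mono fun t ht => ht.2) le_rfl).trans_lt ?_
    exact ENNReal.mul_lt_top (ENNReal.rpow_lt_top_of_nonneg (by norm_num) ENNReal.coe_ne_top) hL3
  -- ### Step 3: parameters and the constants of the ε-regularity criterion
  obtain ⟨ε₀, C₀, hε₀, -, H⟩ := (lemarieRieusset_epsilon_regularity_iff.1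
    (lemarieRieusset_epsilon_regularity_of_lemma15_12 RRS2016.lemma15_12_holds)) ν 3 hν (by norm_num)
  set t₁ : ℝ := T' / 2 with ht₁
  have ht₁pos : 0 < t₁ := by positivity
  set τ : ℝ := t₁ / 4 with hτ
  have hτpos : 0 < τ := by positivity
  set r₀ : ℝ := min (Real.sqrt (t₁ / 2)) 1 with hr₀
  have hr₀pos : 0 < r₀ := lt_min (Real.sqrt_pos.2 (by positivity)) one_pos
  have hr₀1 : r₀ ≤ 1 := min_le_right _ _
  have hr₀sq : r₀ ^ 2 ≤ t₁ / 2 := by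
    calc r₀ ^ 2 ≤ Real.sqrt (t₁ / 2) ^ 2 := pow_le_pow_left₀ hr₀pos.le (min_le_left _ _) 2
      _ = t₁ / 2 := Real.sq_sqrt (by positivity)
  -- ### Step 4: the tails of `|ũ|³` and `|P|^{3/2}` are eventually below the threshold
  have htail_u := tendsto_setLIntegral_prod_compl_closedBall (Ioo 0 T') (0 : EuclideanSpace ℝ (Fin 3)) hL3
  have htail_p := tendsto_setLIntegral_prod_compl_closedBall (Ioo 0 T') (0 : EuclideanSpace ℝ (Fin 3)) hP32
  have hthr : (0 : ℝ≥0∞) < ENNReal.ofReal (ε₀ ^ 3 * r₀ ^ 2) := ENNReal.ofReal_pos.2 (by positivity)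
  have hsum := htail_u.add htail_p
  rw [add_zero] at hsum
  obtain ⟨N, hN⟩ := eventually_atTop.1 (hsum.eventually (Iio_mem_nhds hthr))
  have hNle := (hN N le_rfl).le
  set R' : ℝ := (N : ℝ) + 1 with hR'
  -- ### Step 5: the bound on one half-cylinder `Q_{r₀/2}(t, x)`, `t₁ < t < T'`, `|x| > R'`
  have key : ∀ (t : ℝ) (x : EuclideanSpace ℝ (Fin 3)), t₁ < t → t < T' → R' < ‖x‖ →
      ∀ᵐ w ∂(volume.restrict (parabolicCylinder (r₀ / 2) ((t : ℝ), x))),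
        ‖u (s + w.1) w.2‖ ≤ C₀ * ε₀ / r₀ := by
    intro t x ht₁t htT hxR
    set S : ℝ := (t + T') / 2 with hS
    have hSpos : 0 < S := by rw [hS]; linarith
    have hST' : S < T' := by rw [hS]; linarith
    have htS : t < S := by rw [hS]; linarith
    set S' : ℝ := (t + S) / 2 with hS'
    have htS' : t < S' := by rw [hS']; linarith
    have hS'S : S' < S := by rw [hS']; linarith
    obtain ⟨p, hpm, -, hpsl, hpfin, hsuit⟩ := hũ.exists_rieszPressure_suitable_slab hν hSpos hST'
    -- the box `Ω = (τ, S') × B(x, 3/2)` and its compact closure inside the slab `(0, S)`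
    let Ω : Opens (ℝ × EuclideanSpace ℝ (Fin 3)) :=
      ⟨Ioo τ S' ×ˢ ball x (3 / 2), isOpen_Ioo.prod isOpen_ball⟩
    have hΩle : Ω ≤ slab (EuclideanSpace ℝ (Fin 3)) (Ioo 0 S) isOpen_Ioo := fun z hz =>
      mem_slab.2 ⟨hτpos.trans hz.1.1, hz.1.2.trans hS'S⟩
    set K : Set (ℝ × EuclideanSpace ℝ (Fin 3)) := Icc τ S' ×ˢ closedBall x (3 / 2) with hK
    have hKc : IsCompact K := isCompact_Icc.prod (isCompact_closedBall _ _)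
    have hΩK : (Ω : Set (ℝ × EuclideanSpace ℝ (Fin 3))) ⊆ K := prod_mono Ioo_subset_Icc_self ball_subset_closedBall
    have hKs : K ⊆ (slab (EuclideanSpace ℝ (Fin 3)) (Ioo 0 S) isOpen_Ioo : Set (ℝ × EuclideanSpace ℝ (Fin 3))) :=
      fun z hz => ⟨⟨hτpos.trans_le hz.1.1, hz.1.2.trans_lt hS'S⟩, mem_univ _⟩
    obtain ⟨G, hG, hG2, hloc⟩ := hsuit.localEnergy
    have hLR : IsLRSuitableWeakSolutionOn Ω ν 3 0 (fun t => u (s + t)) p G :=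
      { isConnected := (isConnected_Ioo (by linarith : τ < S')).prod (isConnected_ball (by norm_num))
        energyClass := by
          obtain ⟨C, hC⟩ := hsuit.energyClass K hKs hKc
          exact ⟨C, hC.mono fun s' hs' => (lintegral_mono fun y =>
            indicator_le_indicator_of_subset hΩK (fun _ => zero_le) _).trans hs'⟩
        weakGradient := hG.mono hΩle
        gradient_lt_top := (lintegral_mono_set hΩK).trans_lt (hG2 K hKs hKc)
        pressure_lt_top := (lintegral_mono_set hΩK).trans_lt (hsuit.pressure K hKs hKc)
        force_memLp := by
          rw [uncurry_zero]
          exact MemLp.zero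
        distributional := (hsuit.of_le hΩle).distributional
        localEnergy := fun φ hφ hφ0 => hloc φ (hφ.mono hΩle) hφ0 }
    -- the cylinder `Q_{r₀}(t, x)` lies in `Ω`, below `S`, and in the far region
    have ht0 : τ ≤ t - r₀ ^ 2 := by rw [hτ]; linarith
    have hcylΩ : parabolicCylinder r₀ ((t : ℝ), x) ⊆ (Ω : Set (ℝ × EuclideanSpace ℝ (Fin 3))) := by
      intro w hw
      rw [mem_parabolicCylinder] at hw
      exact ⟨⟨by linarith [hw.1.1], by linarith [hw.1.2]⟩, mem_ball.2 (by linarith [hw.2])⟩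
    have hcylI : parabolicCylinder r₀ ((t : ℝ), x) = Ioo (t - r₀ ^ 2) t ×ˢ ball x r₀ := rfl
    have hIS : Ioo (t - r₀ ^ 2) t ⊆ Ioo 0 S := fun r hr => ⟨by linarith [hr.1], hr.2.trans htS⟩
    have hIT : Ioo (t - r₀ ^ 2) t ⊆ Ioo 0 T' := fun r hr => ⟨by linarith [hr.1], hr.2.trans htT⟩
    have hcylFar : parabolicCylinder r₀ ((t : ℝ), x) ⊆
        Ioo 0 T' ×ˢ (closedBall (0 : EuclideanSpace ℝ (Fin 3)) (N : ℝ))ᶜ := by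
      intro w hw
      rw [mem_parabolicCylinder] at hw
      refine ⟨hIT hw.1, ?_⟩
      rw [mem_compl_iff, mem_closedBall, dist_zero_right, not_le]
      have h1 : ‖x‖ ≤ ‖w.2‖ + dist w.2 x := by
        have := norm_sub_norm_le x w.2
        rw [dist_eq_norm, ← norm_sub_rev x w.2]
        linarith
      rw [hR'] at hxR
      linarith [hw.2]
    -- the smallness of `∫∫_Q (|ũ|³ + |p|^{3/2})`
    have hpeq : ∫⁻ w in parabolicCylinder r₀ ((t : ℝ), x), ‖p w.1 w.2‖ₑ ^ (3 / 2 : ℝ) =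
        ∫⁻ w in parabolicCylinder r₀ ((t : ℝ), x), ‖P w.1 w.2‖ₑ ^ (3 / 2 : ℝ) := by
      rw [hcylI]
      refine setLIntegral_prod_eq_of_ae_slice_eq
        (hpm.mono_measure (Measure.restrict_mono (prod_mono hIS Subset.rfl) le_rfl))
        (hPm.mono_measure (Measure.restrict_mono (prod_mono hIT Subset.rfl) le_rfl)) ?_ _ _
      filter_upwards [ae_restrict_of_ae_restrict_of_subset hIS hpsl,
        ae_restrict_of_ae_restrict_of_subset hIT hP] with r hr1 hr2
      exact hr1.1.trans hr2.1.symm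
    have humeas : AEMeasurable (fun w : ℝ × EuclideanSpace ℝ (Fin 3) => ‖u (s + w.1) w.2‖ₑ ^ (3 : ℕ))
        (volume.restrict (parabolicCylinder r₀ ((t : ℝ), x))) :=
      ((hũ.aestronglyMeasurable.mono_measure (Measure.restrict_mono
        (hcylFar.trans (prod_mono Subset.rfl (subset_univ _))) le_rfl)).enorm.pow_const _)
    have hsmall : ∫⁻ w in parabolicCylinder r₀ ((t : ℝ), x),
        (‖u (s + w.1) w.2‖ₑ ^ (3 : ℕ) + ‖p w.1 w.2‖ₑ ^ (3 / 2 : ℝ)) ≤ ENNReal.ofReal (ε₀ ^ 3 * r₀ ^ 2) := by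
      rw [lintegral_add_left' humeas, hpeq]
      refine le_trans (add_le_add ?_ ?_) hNle
      · calc ∫⁻ w in parabolicCylinder r₀ ((t : ℝ), x), ‖u (s + w.1) w.2‖ₑ ^ (3 : ℕ)
            = ∫⁻ w in parabolicCylinder r₀ ((t : ℝ), x), ‖u (s + w.1) w.2‖ₑ ^ (3 : ℝ) := by
              refine lintegral_congr fun w => ?_
              rw [show (3 : ℝ) = ((3 : ℕ) : ℝ) by norm_num, ENNReal.rpow_natCast]
          _ ≤ _ := lintegral_mono_set hcylFar
      · exact lintegral_mono_set hcylFar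
    refine H Ω 0 (fun t => u (s + t)) p G hLR (t, x) r₀ ε₀ hr₀pos hcylΩ hε₀.le le_rfl hsmall ?_
    simp
  -- ### Step 6: countably many half-cylinders cover the far region `(t₁, T') × {|y| > R' + 1}`
  obtain ⟨D₁, hD₁c, hD₁d⟩ := TopologicalSpace.exists_countable_dense ℝ
  obtain ⟨D₃, hD₃c, hD₃d⟩ := TopologicalSpace.exists_countable_dense (EuclideanSpace ℝ (Fin 3))
  set Sx : Set (ℝ × EuclideanSpace ℝ (Fin 3)) :=
    {q | q ∈ D₁ ×ˢ D₃ ∧ t₁ < q.1 ∧ q.1 < T' ∧ R' < ‖q.2‖} with hSx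
  have hSc : Sx.Countable := (hD₁c.prod hD₃c).mono fun q hq => hq.1
  have hU : ∀ᵐ w ∂(volume.restrict (⋃ q ∈ Sx, parabolicCylinder (r₀ / 2) ((q.1 : ℝ), q.2))),
      ‖u (s + w.1) w.2‖ ≤ C₀ * ε₀ / r₀ := by
    rw [ae_restrict_biUnion_iff _ hSc]
    rintro ⟨t, x⟩ ⟨-, ht, htT, hx⟩
    exact key t x ht htT hx
  have hUfar : ∀ᵐ w ∂(volume.restrict (Ioo t₁ T' ×ˢ (closedBall (0 : EuclideanSpace ℝ (Fin 3)) (R' + 1))ᶜ)),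
      ‖u (s + w.1) w.2‖ ≤ C₀ * ε₀ / r₀ :=
    ae_restrict_of_ae_restrict_of_subset (far_region_subset_biUnion_lt hD₁d hD₃d R' le_rfl hr₀pos hr₀1) hU
  -- ### Step 7: translate back to `u`
  refine ⟨T' - t₁, by rw [ht₁]; linarith, R' + 1, ?_⟩
  rw [eLpNorm_exponent_top]
  refine eLpNormEssSup_lt_top_of_ae_bound (C := C₀ * ε₀ / r₀) ?_
  let e : ℝ × EuclideanSpace ℝ (Fin 3) ≃ᵐ ℝ × EuclideanSpace ℝ (Fin 3) :=
    MeasurableEquiv.prodCongr (MeasurableEquiv.addRight s) (MeasurableEquiv.refl _)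
  have he : ∀ w : ℝ × EuclideanSpace ℝ (Fin 3), e w = (w.1 + s, w.2) := fun w => rfl
  have hmp : MeasurePreserving e volume volume := by
    have h := (measurePreserving_add_right (volume : Measure ℝ) s).prod
      (MeasurePreserving.id (volume : Measure (EuclideanSpace ℝ (Fin 3))))
    exact h
  set A : Set (ℝ × EuclideanSpace ℝ (Fin 3)) :=
    Ioo (T - (T' - t₁)) T ×ˢ (closedBall (0 : EuclideanSpace ℝ (Fin 3)) (R' + 1))ᶜ with hA
  have hAm : MeasurableSet A := measurableSet_Ioo.prod measurableSet_closedBall.compl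
  have hpre : e ⁻¹' A = Ioo t₁ T' ×ˢ (closedBall (0 : EuclideanSpace ℝ (Fin 3)) (R' + 1))ᶜ := by
    ext ⟨r, y⟩
    simp only [mem_preimage, he, hA, mem_prod, mem_Ioo, hT']
    constructor
    · rintro ⟨⟨h1, h2⟩, h3⟩; exact ⟨⟨by linarith, by linarith⟩, h3⟩
    · rintro ⟨⟨h1, h2⟩, h3⟩; exact ⟨⟨by linarith, by linarith⟩, h3⟩
  have hmp' := hmp.restrict_preimage hAm
  rw [← hmp'.map_eq, e.measurableEmbedding.ae_map_iff, hpre]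
  filter_upwards [hUfar] with w hw
  show ‖u (e w).1 (e w).2‖ ≤ C₀ * ε₀ / r₀
  rw [he, add_comm]
  exact hw

/-- **Lemarié-Rieusset's Thm. 15.1 (C) holds** (`lemarieRieusset_singular_point_of_blowup`;
*The Navier–Stokes problem in the 21st century*, Thm. 15.1 (C), proof pp. 565–566), from the
tree's assembly `lemarieRieusset_singular_point_of_blowup_of_facts` and the discharged leaves
`kato_local_bounded_holds`, `IsKatoSolutionOn.farField_bound_holds`.
[cite: LemarieRieusset2016, Thm. 15.1 (C) and its proof, PDF pp. 565–566] -/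
theorem lemarieRieusset_singular_point_of_blowup_holds : lemarieRieusset_singular_point_of_blowup :=
  lemarieRieusset_singular_point_of_blowup_of_facts kato_local_bounded_holds
    IsKatoSolutionOn.farField_bound_holds

/-- **Rusin–Šverák's "finite `T_max` forces a singular point" holds**
(`rusin_sverak_singular_point_of_blowup`; W. Rusin, V. Šverák, J. Funct. Anal. 260 (2011) =
arXiv:0911.0500, §4 p. 6, paragraph after Thm. 4.1), from the tree's assembly
`rusin_sverak_singular_point_of_blowup_of_facts` and the discharged leaves `kato_local_holds`,
`kato_local_bounded_holds`, `IsKatoSolutionOn.farField_bound_holds`.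
[cite: RusinSverak2011, §4 p. 6 (paragraph after Thm. 4.1), arXiv:0911.0500] -/
theorem rusin_sverak_singular_point_of_blowup_holds : rusin_sverak_singular_point_of_blowup :=
  rusin_sverak_singular_point_of_blowup_of_facts kato_local_holds kato_local_bounded_holds
    IsKatoSolutionOn.farField_bound_holds

end Literature.Analysis.FluidPDE

end
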